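import Summits.SmoothPoincare4.SmoothPoincare4.Theorems.ContractibleTwistedDoubleStandard.Negative.DoubleBisection
import Literature.AlgebraicTopology.SingularHomology.ExcisionMayerVietoris
import Literature.Topology.FourManifolds.CerfGammaFourProofs

/-!
# `AcyclicBisectionRigidity` — negative-side support: seam-compatible twins and the three sectors

Support lemmas for the crux
`Summit.SmoothPoincare4.SmoothPoincare4.Theses.ConvexBisection.AcyclicBisectionRigidity`
(stmt-SmoothPoincare4-10507), from the standing disprover's work file
`Cruxes/AcyclicBisectionRigidity/Disproof.lean` §12b (every statement inline):

* `isDouble_of_seamCompatible` — if the two halves of a bisection are related by a diffeomorphism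
  `Φ : W₁ ≅ W₂` which along `∂W₁` IS the seam identification (`e₂ (Φ w) = e₁ w`), then the
  ambient manifold is a DOUBLE of `W₁` in the sense of `Literature.Topology.FourManifolds.IsDouble`
  (pieces `e₁`, `e₂ ∘ Φ`);
* `map_mfderiv_eq_of_seamCompatible` — such a `Φ` automatically carries any boundary plane field
  `ξ₁ ≤ T∂W₁` matched across the seam onto `ξ₂` (it is a contact twin);
* `crux_iff_threeSectors` — hence the crux is EQUIVALENT to the conjunction of three
  SPC4-shielded sectors: (1) homotopy-sphere doubles of one ℚ-acyclic Stein domain are `S⁴`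
  (on paper: presentation spheres, the identity-glued slice of crux 4); (2) CONTACT CORK TWISTS of
  such doubles (contact-twin halves, no seam-compatible twin datum: the gluing contactomorphism
  extends over neither half; inhabited by the `S³/Q₈` bisection of `S⁴`); (3) regluings of
  NON-contact-diffeomorphic acyclic Stein pairs (empty iff the line's lever
  `stub_minimalFactorisationTwins`). The line's two residual stubs prove exactly (1) ∧ (2)
  (`Negative/TwinDecomposition.lean` + this file).
-/

noncomputable section

-- The namespace is prescribed by the crux protocol (`Summit.<P>.<Sub>.Theorems.<Crux>.Negative`
-- with `P = Sub = SmoothPoincare4`), hence the duplicated component.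
set_option linter.dupNamespace false

open scoped Manifold ContDiff Topology ContinuousMap
open Set Function Literature.Geometry.Symplectic Literature.AlgebraicTopology.SingularHomology
  Literature.Topology.FourManifolds CategoryTheory.Limits

namespace Summit.SmoothPoincare4.SmoothPoincare4.Theorems.AcyclicBisectionRigidity.Negative

open Summit.SmoothPoincare4.SmoothPoincare4.Theses.ConvexBisection
open Summit.SmoothPoincare4.SmoothPoincare4.Theorems.ContractibleTwistedDoubleStandard.Negative
  (steinBisection_of_isDouble mfderiv_apply_eq_of_comp_incl_eq)

section SeamCompatible

variable {M : Type} [TopologicalSpace M] [ChartedSpace (EuclideanSpace ℝ (Fin 4)) M]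
  {W₁ : Type} [TopologicalSpace W₁] [ChartedSpace (EuclideanHalfSpace 4) W₁] [IsManifold (𝓡∂ 4) ∞ W₁]
  {W₂ : Type} [TopologicalSpace W₂] [ChartedSpace (EuclideanHalfSpace 4) W₂] [IsManifold (𝓡∂ 4) ∞ W₂]

/-- **Seam-compatible twins present the ambient manifold as a DOUBLE.** If `e₁ : W₁ → M`,
`e₂ : W₂ → M` are smooth embeddings of compact pieces covering `M` and meeting exactly along
`e₁(∂W₁)`, and `Φ : W₁ ≅ W₂` satisfies `e₂ (Φ w) = e₁ w` on `∂W₁`, then `M` is a double of `W₁`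
along any boundary datum `b` (pieces `e₁` and `e₂ ∘ Φ`; the gluing relation collapses to the
identity of `∂W₁` by the seam condition and injectivity). [folklore] -/
theorem isDouble_of_seamCompatible {e₁ : W₁ → M} {e₂ : W₂ → M}
    (he₁ : Manifold.IsSmoothEmbedding (𝓡∂ 4) (𝓡 4) ∞ e₁)
    (he₂ : Manifold.IsSmoothEmbedding (𝓡∂ 4) (𝓡 4) ∞ e₂)
    (hcover : range e₁ ∪ range e₂ = univ)
    (hseam₁ : range e₁ ∩ range e₂ = e₁ '' (𝓡∂ 4).boundary W₁)
    (Φ : W₁ ≃ₘ⟮𝓡∂ 4, 𝓡∂ 4⟯ W₂) (hΦ : ∀ w, w ∈ (𝓡∂ 4).boundary W₁ → e₂ (Φ w) = e₁ w)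
    (b : BoundaryData (𝓡∂ 4) W₁ (𝓡 3)) : IsDouble b (𝓡 4) M := by
  have hsurj : Function.Surjective (Φ : W₁ → W₂) := fun y => ⟨Φ.symm y, Φ.apply_symm_apply y⟩
  have hrange : range (e₂ ∘ Φ) = range e₂ := by rw [range_comp, hsurj.range_eq, image_univ]
  refine ⟨e₁, e₂ ∘ Φ, he₁, he₂.comp_diffeomorph Φ, by rw [hrange]; exact hcover, fun a a' => ?_⟩
  constructor
  · intro h
    have hmem : e₁ a ∈ range e₁ ∩ range e₂ := ⟨⟨a, rfl⟩, ⟨Φ a', h.symm⟩⟩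
    rw [hseam₁] at hmem
    obtain ⟨a₀, ha₀, hae⟩ := hmem
    have haa : a₀ = a := he₁.isEmbedding.injective hae
    subst haa
    have ha' : a₀ ∈ range b.incl := by rw [b.range_incl]; exact ha₀
    obtain ⟨z, rfl⟩ := ha'
    refine ⟨z, rfl, ?_⟩
    have h2 : e₂ (Φ a') = e₂ (Φ (b.incl z)) := by
      rw [show (e₂ ∘ Φ) a' = e₂ (Φ a') from rfl] at h
      rw [← h, hΦ _ ha₀]
    exact Φ.injective (he₂.isEmbedding.injective h2)
  · rintro ⟨z, rfl, rfl⟩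
    exact (hΦ _ (b.incl_mem_boundary z)).symm

/-- **Seam-compatible twins are contact twins.** With `e₁`, `e₂` as above (into a smooth `M`) and
boundary plane fields `ξ₁ ≤ T∂W₁` on `W₁`, `ξ₂` on `W₂` whose push-forwards agree at common seam
points, a seam-compatible `Φ` carries `ξ₁` onto `ξ₂` along `∂W₁`: the differentials of `e₂ ∘ Φ`
and `e₁` agree on `T∂W₁` because the maps agree on `∂W₁` ((A3) of `DoubleBisection.lean`), and
`de₂` is injective. [folklore] -/
theorem map_mfderiv_eq_of_seamCompatible [IsManifold (𝓡 4) ∞ M] (b : BoundaryData (𝓡∂ 4) W₁ (𝓡 3))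
    (ξ₁ : W₁ → Submodule ℝ (EuclideanSpace ℝ (Fin 4))) (ξ₂ : W₂ → Submodule ℝ (EuclideanSpace ℝ (Fin 4)))
    (hξ₁ : ∀ w, ξ₁ w ≤ boundaryTangentSpace)
    {e₁ : W₁ → M} {e₂ : W₂ → M}
    (he₁ : Manifold.IsSmoothEmbedding (𝓡∂ 4) (𝓡 4) ∞ e₁)
    (he₂ : Manifold.IsSmoothEmbedding (𝓡∂ 4) (𝓡 4) ∞ e₂)
    (hξ : ∀ w₁ w₂, e₁ w₁ = e₂ w₂ →
      Submodule.map (mfderiv (𝓡∂ 4) (𝓡 4) e₁ w₁).toLinearMap (ξ₁ w₁) =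
      Submodule.map (mfderiv (𝓡∂ 4) (𝓡 4) e₂ w₂).toLinearMap (ξ₂ w₂))
    (Φ : W₁ ≃ₘ⟮𝓡∂ 4, 𝓡∂ 4⟯ W₂) (hΦ : ∀ w, w ∈ (𝓡∂ 4).boundary W₁ → e₂ (Φ w) = e₁ w) :
    ∀ w, w ∈ (𝓡∂ 4).boundary W₁ →
      Submodule.map (mfderiv (𝓡∂ 4) (𝓡∂ 4) Φ w).toLinearMap (ξ₁ w) = ξ₂ (Φ w) := by
  intro w hw
  have hw' : w ∈ range b.incl := by rw [b.range_incl]; exact hw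
  obtain ⟨z, rfl⟩ := hw'
  have hcomp : (e₂ ∘ Φ) ∘ b.incl = e₁ ∘ b.incl :=
    funext fun z => hΦ _ (b.incl_mem_boundary z)
  have hA : ContMDiff (𝓡∂ 4) (𝓡 4) ∞ (e₂ ∘ Φ) := (he₂.comp_diffeomorph Φ).contMDiff
  have hagree : ∀ v ∈ ξ₁ (b.incl z),
      mfderiv (𝓡∂ 4) (𝓡 4) (e₂ ∘ Φ) (b.incl z) v = mfderiv (𝓡∂ 4) (𝓡 4) e₁ (b.incl z) v :=
    fun v hv => mfderiv_apply_eq_of_comp_incl_eq b hA he₁.contMDiff hcomp z (hξ₁ _ hv)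
  have hd₂ : MDifferentiableAt (𝓡∂ 4) (𝓡 4) e₂ (Φ (b.incl z)) :=
    he₂.contMDiff.mdifferentiableAt (by simp)
  have hdΦ : MDifferentiableAt (𝓡∂ 4) (𝓡∂ 4) Φ (b.incl z) := Φ.mdifferentiable (by simp) _
  have hchain : mfderiv (𝓡∂ 4) (𝓡 4) (e₂ ∘ Φ) (b.incl z) =
      (mfderiv (𝓡∂ 4) (𝓡 4) e₂ (Φ (b.incl z))).comp (mfderiv (𝓡∂ 4) (𝓡∂ 4) Φ (b.incl z)) :=
    mfderiv_comp _ hd₂ hdΦ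
  have hseam := hξ (b.incl z) (Φ (b.incl z)) (hΦ _ (b.incl_mem_boundary z)).symm
  have hinj : Injective (mfderiv (𝓡∂ 4) (𝓡 4) e₂ (Φ (b.incl z))) :=
    Manifold.IsImmersionAt.mfderiv_injective (he₂.isImmersion.isImmersionAt _) (by simp)
  set D₁ : (EuclideanSpace ℝ (Fin 4)) →L[ℝ] (EuclideanSpace ℝ (Fin 4)) :=
    mfderiv (𝓡∂ 4) (𝓡 4) e₁ (b.incl z) with hD₁
  set D₂ : (EuclideanSpace ℝ (Fin 4)) →L[ℝ] (EuclideanSpace ℝ (Fin 4)) :=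
    mfderiv (𝓡∂ 4) (𝓡 4) e₂ (Φ (b.incl z)) with hD₂
  set DΦ : (EuclideanSpace ℝ (Fin 4)) →L[ℝ] (EuclideanSpace ℝ (Fin 4)) :=
    mfderiv (𝓡∂ 4) (𝓡∂ 4) Φ (b.incl z) with hDΦ
  have hagree' : ∀ v ∈ ξ₁ (b.incl z), D₂ (DΦ v) = D₁ v := by
    intro v hv
    have := hagree v hv
    rw [hchain] at this
    exact this
  apply Submodule.map_injective_of_injective (f := D₂.toLinearMap) hinj
  refine Eq.trans ?_ hseam
  ext x
  simp only [Submodule.mem_map, ContinuousLinearMap.coe_coe]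
  constructor
  · rintro ⟨u, ⟨v, hv, rfl⟩, rfl⟩
    exact ⟨v, hv, (hagree' v hv).symm⟩
  · rintro ⟨v, hv, rfl⟩
    exact ⟨DΦ v, ⟨v, hv, rfl⟩, hagree' v hv⟩

end SeamCompatible

/-- **THREE-SECTOR DECOMPOSITION OF THE CRUX.** `AcyclicBisectionRigidity` is EQUIVALENT to the
conjunction of: (1) the DOUBLE SECTOR — every `IsDouble` of one compact ℚ-acyclic Stein domain
that is a homotopy 4-sphere is `S⁴`; (2) the CORK-TWIST SECTOR — acyclic common-contact Stein
bisections of homotopy spheres whose halves are contact twins (`∃ Φ : W₁ ≅ W₂` carrying `ξ₁` to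
`ξ₂` on `∂W₁`) but admit NO seam-compatible twin datum (`¬ ∃ Φ, e₂ ∘ Φ = e₁` on `∂W₁`) give
`S⁴`; (3) the NON-TWIN SECTOR — the same for halves that are not contact twins. (`→`: doubles
are bisections, `steinBisection_of_isDouble`; `←`: excluded middle twice, a seam-compatible
twin datum making `M` an `IsDouble` of `W₁`, `isDouble_of_seamCompatible`, with a boundary datum
from `nonempty_boundaryData_holds`.) [folklore] -/
theorem crux_iff_threeSectors : AcyclicBisectionRigidity ↔
    (∀ (W : Type) [TopologicalSpace W] [ChartedSpace (EuclideanHalfSpace 4) W]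
        [IsManifold (𝓡∂ 4) ∞ W] [CompactSpace W] (_J : SteinStructure W)
        (b : BoundaryData (𝓡∂ 4) W (𝓡 3))
        (P : Type) [TopologicalSpace P] [T2Space P] [SecondCountableTopology P]
        [ChartedSpace (EuclideanSpace ℝ (Fin 4)) P] [IsManifold (𝓡 4) ∞ P],
        IsDouble b (𝓡 4) P → (∀ k, 0 < k → IsZero (singularHomology ℚ ℚ W k)) →
        P ≃ₕ Metric.sphere (0 : EuclideanSpace ℝ (Fin 5)) 1 →
        Nonempty (P ≃ₘ⟮𝓡 4, 𝓡 4⟯ Metric.sphere (0 : EuclideanSpace ℝ (Fin 5)) 1)) ∧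
    (∀ (M : Type) [TopologicalSpace M] [T2Space M] [SecondCountableTopology M]
      [ChartedSpace (EuclideanSpace ℝ (Fin 4)) M] [IsManifold (𝓡 4) ∞ M]
      (_hM : M ≃ₕ Metric.sphere (0 : EuclideanSpace ℝ (Fin 5)) 1)
      (W₁ : Type) [TopologicalSpace W₁] [ChartedSpace (EuclideanHalfSpace 4) W₁] [IsManifold (𝓡∂ 4) ∞ W₁]
      [CompactSpace W₁] (W₂ : Type) [TopologicalSpace W₂] [ChartedSpace (EuclideanHalfSpace 4) W₂]
      [IsManifold (𝓡∂ 4) ∞ W₂] [CompactSpace W₂] (J₁ : SteinStructure W₁) (J₂ : SteinStructure W₂)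
      (e₁ : W₁ → M) (e₂ : W₂ → M)
      (_he₁ : Manifold.IsSmoothEmbedding (𝓡∂ 4) (𝓡 4) ∞ e₁)
      (_he₂ : Manifold.IsSmoothEmbedding (𝓡∂ 4) (𝓡 4) ∞ e₂)
      (_hcover : range e₁ ∪ range e₂ = univ)
      (_hseam₁ : range e₁ ∩ range e₂ = e₁ '' (𝓡∂ 4).boundary W₁)
      (_hseam₂ : range e₁ ∩ range e₂ = e₂ '' (𝓡∂ 4).boundary W₂)
      (_hξ : ∀ w₁ w₂, e₁ w₁ = e₂ w₂ →
        Submodule.map (mfderiv (𝓡∂ 4) (𝓡 4) e₁ w₁).toLinearMap (contactPlane J₁.J w₁) =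
        Submodule.map (mfderiv (𝓡∂ 4) (𝓡 4) e₂ w₂).toLinearMap (contactPlane J₂.J w₂))
      (_hac : ∀ k, 0 < k → IsZero (singularHomology ℚ ℚ W₁ k) ∧ IsZero (singularHomology ℚ ℚ W₂ k)),
      (∃ Φ : W₁ ≃ₘ⟮𝓡∂ 4, 𝓡∂ 4⟯ W₂, ∀ w, w ∈ (𝓡∂ 4).boundary W₁ →
        Submodule.map (mfderiv (𝓡∂ 4) (𝓡∂ 4) Φ w).toLinearMap (contactPlane J₁.J w) =
          contactPlane J₂.J (Φ w)) →
      ¬ (∃ Φ : W₁ ≃ₘ⟮𝓡∂ 4, 𝓡∂ 4⟯ W₂, ∀ w, w ∈ (𝓡∂ 4).boundary W₁ → e₂ (Φ w) = e₁ w) →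
      Nonempty (M ≃ₘ⟮𝓡 4, 𝓡 4⟯ Metric.sphere (0 : EuclideanSpace ℝ (Fin 5)) 1)) ∧
    (∀ (M : Type) [TopologicalSpace M] [T2Space M] [SecondCountableTopology M]
      [ChartedSpace (EuclideanSpace ℝ (Fin 4)) M] [IsManifold (𝓡 4) ∞ M]
      (_hM : M ≃ₕ Metric.sphere (0 : EuclideanSpace ℝ (Fin 5)) 1)
      (W₁ : Type) [TopologicalSpace W₁] [ChartedSpace (EuclideanHalfSpace 4) W₁] [IsManifold (𝓡∂ 4) ∞ W₁]
      [CompactSpace W₁] (W₂ : Type) [TopologicalSpace W₂] [ChartedSpace (EuclideanHalfSpace 4) W₂]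
      [IsManifold (𝓡∂ 4) ∞ W₂] [CompactSpace W₂] (J₁ : SteinStructure W₁) (J₂ : SteinStructure W₂)
      (e₁ : W₁ → M) (e₂ : W₂ → M)
      (_he₁ : Manifold.IsSmoothEmbedding (𝓡∂ 4) (𝓡 4) ∞ e₁)
      (_he₂ : Manifold.IsSmoothEmbedding (𝓡∂ 4) (𝓡 4) ∞ e₂)
      (_hcover : range e₁ ∪ range e₂ = univ)
      (_hseam₁ : range e₁ ∩ range e₂ = e₁ '' (𝓡∂ 4).boundary W₁)
      (_hseam₂ : range e₁ ∩ range e₂ = e₂ '' (𝓡∂ 4).boundary W₂)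
      (_hξ : ∀ w₁ w₂, e₁ w₁ = e₂ w₂ →
        Submodule.map (mfderiv (𝓡∂ 4) (𝓡 4) e₁ w₁).toLinearMap (contactPlane J₁.J w₁) =
        Submodule.map (mfderiv (𝓡∂ 4) (𝓡 4) e₂ w₂).toLinearMap (contactPlane J₂.J w₂))
      (_hac : ∀ k, 0 < k → IsZero (singularHomology ℚ ℚ W₁ k) ∧ IsZero (singularHomology ℚ ℚ W₂ k)),
      ¬ (∃ Φ : W₁ ≃ₘ⟮𝓡∂ 4, 𝓡∂ 4⟯ W₂, ∀ w, w ∈ (𝓡∂ 4).boundary W₁ →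
        Submodule.map (mfderiv (𝓡∂ 4) (𝓡∂ 4) Φ w).toLinearMap (contactPlane J₁.J w) =
          contactPlane J₂.J (Φ w)) →
      Nonempty (M ≃ₘ⟮𝓡 4, 𝓡 4⟯ Metric.sphere (0 : EuclideanSpace ℝ (Fin 5)) 1)) := by
  constructor
  · intro h
    refine ⟨?_, ?_, ?_⟩
    · intro W _ _ _ _ J b P _ _ _ _ _ hD hac hP
      obtain ⟨jA, jB, hA, hB, hU, hL, hR, hC⟩ := steinBisection_of_isDouble b J hD
      exact h P hP ⟨W, _, _, _, _, W, _, _, _, _, J, J, jA, jB, hA, hB, hU, hL, hR, hC,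
        fun k hk => ⟨hac k hk, hac k hk⟩⟩
    · intro M _ _ _ _ _ hM W₁ _ _ _ _ W₂ _ _ _ _ J₁ J₂ e₁ e₂ he₁ he₂ hcover hseam₁ hseam₂ hξ hac _ _
      exact h M hM ⟨W₁, _, _, _, _, W₂, _, _, _, _, J₁, J₂, e₁, e₂, he₁, he₂, hcover, hseam₁,
        hseam₂, hξ, hac⟩
    · intro M _ _ _ _ _ hM W₁ _ _ _ _ W₂ _ _ _ _ J₁ J₂ e₁ e₂ he₁ he₂ hcover hseam₁ hseam₂ hξ hac _
      exact h M hM ⟨W₁, _, _, _, _, W₂, _, _, _, _, J₁, J₂, e₁, e₂, he₁, he₂, hcover, hseam₁,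
        hseam₂, hξ, hac⟩
  · rintro ⟨hD, hC, hN⟩ M _ _ _ _ _ hM hb
    obtain ⟨W₁, _, _, _, _, W₂, _, _, _, _, J₁, J₂, e₁, e₂, he₁, he₂, hcover, hseam₁, hseam₂, hξ,
      hac⟩ := hb
    by_cases ht : ∃ Φ : W₁ ≃ₘ⟮𝓡∂ 4, 𝓡∂ 4⟯ W₂, ∀ w, w ∈ (𝓡∂ 4).boundary W₁ →
        Submodule.map (mfderiv (𝓡∂ 4) (𝓡∂ 4) Φ w).toLinearMap (contactPlane J₁.J w) =
          contactPlane J₂.J (Φ w)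
    · by_cases hs : ∃ Φ : W₁ ≃ₘ⟮𝓡∂ 4, 𝓡∂ 4⟯ W₂, ∀ w, w ∈ (𝓡∂ 4).boundary W₁ → e₂ (Φ w) = e₁ w
      · obtain ⟨Φ, hΦ⟩ := hs
        haveI : T2Space W₁ := he₁.isEmbedding.t2Space
        haveI : SecondCountableTopology W₁ := he₁.isEmbedding.secondCountableTopology
        obtain ⟨b⟩ := nonempty_boundaryData_holds 3 W₁
        exact hD W₁ J₁ b M (isDouble_of_seamCompatible he₁ he₂ hcover hseam₁ Φ hΦ b)
          (fun k hk => (hac k hk).1) hM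
      · exact hC M hM W₁ W₂ J₁ J₂ e₁ e₂ he₁ he₂ hcover hseam₁ hseam₂ hξ hac ht hs
    · exact hN M hM W₁ W₂ J₁ J₂ e₁ e₂ he₁ he₂ hcover hseam₁ hseam₂ hξ hac ht

end Summit.SmoothPoincare4.SmoothPoincare4.Theorems.AcyclicBisectionRigidity.Negative
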